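import Summits.QuantumFields.YangMills.Theorems.SwapVirialDeficitBlowUpGnomonicLeaderGroupDist
import HarnessLib

/-!
# THE LEADER GROUP DISTANCE TO THE BASE POINT AT THE APEX HUB `1` — the `hD` input of ✓`abs_log_det_tip_mod_rot_group` ∕ ✓`tip_follower_ceiling_mod_rot_group`
# (cell ym-idea-1, skeleton ➎, `stub_core_tip`, hCore S1-group ∕ 'leaderGroupDist_le_apex' of w3 g68's sub-step list 01:31Z: w3 g67's ✓`leaderGroupDist_le` (hub `hubAt δ 1`)
# transposed to the apex hub `1 = hubAt 1 0` (slave entry `slaveP 1`, `radialUnit 1 = 1`); free-hands support of ⟨stmt-QuantumFields-24197⟩ `SwapVirialDeficit.SwapGluedStiffness`)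

* `hubAt_one_zero` — `hubAt 1 0 = 1`; `leaders_apex_letters` — the four leaders of `blowUpPoint 1 (gnomonicPoint (hubAt 1 0) ε η)` as unit quaternions
  (✓`leaders_hubAt_letters`' proof at `σ = 0`, ✓`axisPoint_hubAt 1 0`).
* ★★ `leaderGroupDist_le_apex (ε x y z F F′ μ)` — at the hub `((1 : ℝ) : ℍ)`, for every `μ : Fin 4`:
  `‖su2Quat C_μ(((x₀,0,0),(y₀,0,0)),(0,F′)) − su2Quat C_μ(((x,y),(z,F)))‖ ≤ √(2(x₁²+x₂²)∕(1+|x|²)) + √(2|z|²∕(1+|z|²)) + √(2(y₁²+y₂²)∕(1+|y|²))`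
  — with `x, y, z` the ROTATED leaders `gnoRot ū ℓ` of a tip point (g68's `tipRot_letters` ∕ S0′: `|x⊥|² = (y₀²∕λ²)(|ρ⃗|² + (τ⃗×ρ⃗)²)`, compressed) this is p-uniform off the corner.

HONEST LABEL: quaternion bookkeeping; hCore, `stub_core_tip`, ⟨24197⟩ ∕ ⟨24194⟩ remain OPEN; own crux ⟨22884⟩ `LargeFieldMassRefinementTail` OPEN (blocked-on ⟨19935⟩); the Yang–Mills
mass gap is NOT proved; no summit is proved by a line.  THEOREMS ONLY (0 `def`, 0 `sorry`, no instance), standard axioms.  Width seat ym-line-sfw-p2-w2 g61 (cell ym-idea-1, free hands),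
`--supports stmt-QuantumFields-24197`.  References: [folklore].
-/

set_option autoImplicit false

noncomputable section

open MeasureTheory Quaternion
open scoped BigOperators Quaternion RealInnerProductSpace
open Literature.MathematicalPhysics.QuantumFieldTheory hiding SU2
open Literature.MathematicalPhysics.QuantumLattice
open Literature.Analysis.Calculus (radialUnit radialUnit_def norm_radialUnit)
open Summit.QuantumFields.YangMills.Theorems.SwapTwistDeficit.ToronLog (axisPoint)
open Summit.QuantumFields.YangMills.Theorems.SwapVirialDeficit.ZeroModeSigma (su2Quat_quatToSU2_eq_radialUnit slaveP norm_axisUnit dil3 dil3_apply)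
open Summit.QuantumFields.YangMills.Theorems.SwapVirialDeficit.BlowUp (leaderTuple dil3_one')
open Summit.QuantumFields.YangMills.Theorems.SwapVirialDeficit.Gnomonic

namespace Summit.QuantumFields.YangMills.Theorems.SwapVirialDeficit.BlowUpRing

open Summit.QuantumFields.YangMills.Theorems.FemtoTransferGap
open Summit.QuantumFields.YangMills.Theorems.FemtoTransferGap.TT
open Summit.QuantumFields.YangMills.Theorems.VirialFluxGap.RingDeficit
open Summit.QuantumFields.YangMills.Theorems.SwapVirialDeficit.SwapRing

variable {L : ℕ}

/-- `hubAt 1 0 = 1` (the apex hub). [folklore] -/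
theorem hubAt_one_zero : hubAt 1 0 = ((1 : ℝ) : ℍ) := by
  ext <;> simp [hubAt]

/-- `hubAt 1 0 ≠ 0`. [folklore] -/
theorem hubAt_one_zero_ne_zero : hubAt 1 0 ≠ 0 := by
  rw [hubAt_one_zero]; exact_mod_cast one_ne_zero

/-- ★ **THE LEADERS IN LETTERS AT THE APEX HUB** `hubAt 1 0 = 1`: `Ĉ₀ = ν(x)`, `Ĉ₁ = ĉ⁻¹ν(x)ĉν(z)` (`ĉ = radialUnit (hubAt 1 0)`), `Ĉ₂ = ν(y)`, `Ĉ₃ = ĉ`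
(✓`leaders_hubAt_letters`' proof at `σ = 0`). [folklore] -/
theorem leaders_apex_letters (ε : GnoSign L) (η : GnoCoord L) :
    su2Quat ((blowUpPoint (L := L) 1 (gnomonicPoint (hubAt 1 0) ε η)).1 0) = radialUnit (gnoLetter ε.1.1 η.1.1) ∧
    su2Quat ((blowUpPoint (L := L) 1 (gnomonicPoint (hubAt 1 0) ε η)).1 1) =
      star (radialUnit (hubAt 1 0)) * radialUnit (gnoLetter ε.1.1 η.1.1) * radialUnit (hubAt 1 0) * radialUnit (gnoLetter ε.2.1 η.2.1) ∧
    su2Quat ((blowUpPoint (L := L) 1 (gnomonicPoint (hubAt 1 0) ε η)).1 2) = radialUnit (gnoLetter ε.1.2 η.1.2) ∧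
    su2Quat ((blowUpPoint (L := L) 1 (gnomonicPoint (hubAt 1 0) ε η)).1 3) = radialUnit (hubAt 1 0) := by
  have ha : hubAt 1 0 ≠ 0 := hubAt_one_zero_ne_zero
  have hax : axisPoint (hubAt 1 0) = hubAt 1 0 := axisPoint_hubAt 1 0
  have e0 : (blowUpPoint (L := L) 1 (gnomonicPoint (hubAt 1 0) ε η)).1 =
      leaderTuple (hubAt 1 0) ((gnoLetter ε.1.1 η.1.1, gnoLetter ε.1.2 η.1.2), gnoLetter ε.2.1 η.2.1) := by
    show leaderTuple (hubAt 1 0) (dil3 1 (gnomonicPoint (hubAt 1 0) ε η).2.1) = _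
    rw [dil3_one']; rfl
  rw [e0]
  refine ⟨?_, ?_, ?_, ?_⟩
  · rw [(BlowUp.leaderTuple_apply _ _).1]; exact su2Quat_quatToSU2_eq_radialUnit (gnoLetter_ne_zero _ _)
  · rw [(BlowUp.leaderTuple_apply _ _).2.1, su2Quat_quatToSU2_slaveP_mul (norm_axisUnit ha) (gnoLetter_ne_zero _ _) (gnoLetter_ne_zero _ _), hax,
      su2Quat_quatToSU2_eq_radialUnit (gnoLetter_ne_zero _ _), su2Quat_quatToSU2_eq_radialUnit (gnoLetter_ne_zero _ _)]
  · rw [(BlowUp.leaderTuple_apply _ _).2.2.1]; exact su2Quat_quatToSU2_eq_radialUnit (gnoLetter_ne_zero _ _)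
  · rw [(BlowUp.leaderTuple_apply _ _).2.2.2, su2Quat_quatToSU2_axisUnit ha, hax]

/-- ★★ **THE LEADER GROUP DISTANCE TO THE BASE POINT AT THE APEX HUB** `((1 : ℝ) : ℍ)`: for every `μ : Fin 4`,
`‖su2Quat C_μ(((x₀,0,0),(y₀,0,0)),(0,F′)) − su2Quat C_μ(((x,y),(z,F)))‖ ≤ d_x + d_z + d_y` with `d_x = √(2(x₁²+x₂²)∕(1+|x|²))`, `d_y` likewise, `d_z = √(2|z|²∕(1+|z|²))`
— the `hD` input of ✓`abs_log_det_tip_mod_rot_group` (η′ = the base point, η = the rotated leaders). [folklore] -/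
theorem leaderGroupDist_le_apex (ε : GnoSign L) (x y z : Fin 3 → ℝ) (F F' : Fol L → Fin 3 → ℝ) (μ : Fin 4) :
    ‖su2Quat ((blowUpPoint (L := L) 1 (gnomonicPoint ((1 : ℝ) : ℍ) ε ((((![x 0, 0, 0] : Fin 3 → ℝ), (![y 0, 0, 0] : Fin 3 → ℝ)), ((0 : Fin 3 → ℝ), F')) : GnoCoord L))).1 μ) -
        su2Quat ((blowUpPoint (L := L) 1 (gnomonicPoint ((1 : ℝ) : ℍ) ε (((x, y), (z, F)) : GnoCoord L))).1 μ)‖ ≤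
      Real.sqrt (2 * ((x 1) ^ 2 + (x 2) ^ 2) / (1 + ((x 0) ^ 2 + (x 1) ^ 2 + (x 2) ^ 2))) +
        Real.sqrt (2 * ((z 0) ^ 2 + (z 1) ^ 2 + (z 2) ^ 2) / (1 + ((z 0) ^ 2 + (z 1) ^ 2 + (z 2) ^ 2))) +
        Real.sqrt (2 * ((y 1) ^ 2 + (y 2) ^ 2) / (1 + ((y 0) ^ 2 + (y 1) ^ 2 + (y 2) ^ 2))) := by
  rw [← hubAt_one_zero]
  obtain ⟨b0, b1, b2, b3⟩ := leaders_apex_letters (L := L) ε ((((![x 0, 0, 0] : Fin 3 → ℝ), (![y 0, 0, 0] : Fin 3 → ℝ)), ((0 : Fin 3 → ℝ), F')) : GnoCoord L)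
  obtain ⟨e0, e1, e2, e3⟩ := leaders_apex_letters (L := L) ε (((x, y), (z, F)) : GnoCoord L)
  -- the three elementary distances
  have dX : ‖radialUnit (gnoLetter ε.1.1 (![x 0, 0, 0] : Fin 3 → ℝ)) - radialUnit (gnoLetter ε.1.1 x)‖ ≤
      Real.sqrt (2 * ((x 1) ^ 2 + (x 2) ^ 2) / (1 + ((x 0) ^ 2 + (x 1) ^ 2 + (x 2) ^ 2))) := by
    rw [norm_sub_rev]
    exact (Real.le_sqrt (norm_nonneg _) (by positivity)).2 (norm_radialUnit_gnoLetter_sub_axial_sq_le ε.1.1 x)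
  have dY : ‖radialUnit (gnoLetter ε.1.2 (![y 0, 0, 0] : Fin 3 → ℝ)) - radialUnit (gnoLetter ε.1.2 y)‖ ≤
      Real.sqrt (2 * ((y 1) ^ 2 + (y 2) ^ 2) / (1 + ((y 0) ^ 2 + (y 1) ^ 2 + (y 2) ^ 2))) := by
    rw [norm_sub_rev]
    exact (Real.le_sqrt (norm_nonneg _) (by positivity)).2 (norm_radialUnit_gnoLetter_sub_axial_sq_le ε.1.2 y)
  have dZ : ‖radialUnit (gnoLetter ε.2.1 (0 : Fin 3 → ℝ)) - radialUnit (gnoLetter ε.2.1 z)‖ ≤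
      Real.sqrt (2 * ((z 0) ^ 2 + (z 1) ^ 2 + (z 2) ^ 2) / (1 + ((z 0) ^ 2 + (z 1) ^ 2 + (z 2) ^ 2))) := by
    rw [norm_sub_rev]
    exact (Real.le_sqrt (norm_nonneg _) (by positivity)).2 (norm_radialUnit_gnoLetter_sub_zero_sq_le ε.2.1 z)
  have s0 : 0 ≤ Real.sqrt (2 * ((x 1) ^ 2 + (x 2) ^ 2) / (1 + ((x 0) ^ 2 + (x 1) ^ 2 + (x 2) ^ 2))) := Real.sqrt_nonneg _
  have s1 : 0 ≤ Real.sqrt (2 * ((z 0) ^ 2 + (z 1) ^ 2 + (z 2) ^ 2) / (1 + ((z 0) ^ 2 + (z 1) ^ 2 + (z 2) ^ 2))) := Real.sqrt_nonneg _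
  have s2 : 0 ≤ Real.sqrt (2 * ((y 1) ^ 2 + (y 2) ^ 2) / (1 + ((y 0) ^ 2 + (y 1) ^ 2 + (y 2) ^ 2))) := Real.sqrt_nonneg _
  fin_cases μ
  · -- C₀ = X̂
    simp only [Fin.zero_eta] at *
    rw [b0, e0]
    linarith [dX]
  · -- C₁ = ν(a)⁻¹ X̂ ν(a) Ẑ
    simp only [Fin.mk_one] at *
    rw [b1, e1]
    have ha : hubAt 1 0 ≠ 0 := hubAt_one_zero_ne_zero
    have hna : ‖radialUnit (hubAt 1 0)‖ = 1 := norm_radialUnit ha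
    have hsa : ‖star (radialUnit (hubAt 1 0))‖ = 1 := by rw [Quaternion.norm_star, hna]
    have hX : ‖radialUnit (gnoLetter ε.1.1 x)‖ = 1 := norm_radialUnit (gnoLetter_ne_zero _ _)
    have hZ0 : ‖radialUnit (gnoLetter ε.2.1 (0 : Fin 3 → ℝ))‖ = 1 := norm_radialUnit (gnoLetter_ne_zero _ _)
    have h := norm_conj_mul_sub_le (X := radialUnit (gnoLetter ε.1.1 (![x 0, 0, 0] : Fin 3 → ℝ))) (X' := radialUnit (gnoLetter ε.1.1 x))
      (Z := radialUnit (gnoLetter ε.2.1 (0 : Fin 3 → ℝ))) (Z' := radialUnit (gnoLetter ε.2.1 z)) hsa hna hX hZ0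
    linarith [dX, dZ]
  · -- C₂ = Ŷ
    simp only [Fin.reduceFinMk] at *
    rw [b2, e2]
    linarith [dY]
  · -- C₃ = hub
    simp only [Fin.reduceFinMk] at *
    rw [b3, e3, sub_self, norm_zero]
    positivity

end Summit.QuantumFields.YangMills.Theorems.SwapVirialDeficit.BlowUpRing

end
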